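import Summits.QuantumFields.YangMills.Theorems.FradkinShenkerFlowSusceptibilityToPoincareOrbitSliceSplit
import Literature.MathematicalPhysics.QuantumLattice.TorusWilsonMarkov
import HarnessLib

/-!
# Crux `LatticeGapInUVUnits`, line `femto-slab-nondegeneracy`: stub S1r `stub_gaugeReduction` (Elitzur)

Support file for item stmt-QuantumFields-9366 (route `LangevinControlUV` of `YangMills`), registered stub `stub_gaugeReduction`
of `Cruxes/LatticeGapInUVUnits/Lines/femto_slab_nondegeneracy.lean`: for `μ = wilsonMeasure r.ρ β` on `(ℤ/(2S+1))⁴`, a closed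
time-slab `(t₀, w)` and its exterior σ-algebra at margin `D ≥ 2`, the conditional-variance inequality
`Var F ≤ K ∫ (F − μ[F | ext_D])²` for bounded measurable GAUGE-INVARIANT slab observables implies it for ALL bounded
measurable slab observables (same `K ≥ 1`). Proof: orbit-average `F̄ U = ∫ F(U^g) dπ(g)` over the product Haar measure of
the gauge group; gauge invariance of `μ` and Fubini give `∫ F̄ H dμ = ∫ F H dμ` for every bounded measurable `H` invariant
under the gauge transformations supported on the sites touching the slab (`integral_orbitAverage_mul`); for `D ≥ 2` these
fix every exterior link, so `μ[F | ext_D] = μ[F̄ | ext_D]`, `∫ F̄ = ∫ F`, `∫ F̄ F = ∫ F̄²`, and the abstract variance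
reduction `var_le_of_orbit` concludes. References: S. Elitzur, Phys. Rev. D 12 (1975) 3978; F. Martinelli, LNM 1717 (1999) §3.
-/

noncomputable section

open MeasureTheory Filter Topology
open Literature.MathematicalPhysics.QuantumFieldTheory Literature.MathematicalPhysics.QuantumLattice
open Summit.QuantumFields.YangMills.Theorems.SusceptibilityToPoincare
  (measurable_orbitAverage abs_orbitAverage_le continuous_gaugeAction_univ gaugeTransform_mul
    isGaugeInvariant_orbitAverage integral_comp_gaugeTransform_wilsonMeasure)

namespace Summit.QuantumFields.YangMills.Theorems.LatticeGapInUVUnits.FemtoSlabNondegeneracy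

namespace GaugeReduction

section Abstract

variable {Ω : Type*} {m m0 : MeasurableSpace Ω} {μ : Measure Ω} [IsProbabilityMeasure μ]

/-- A bounded measurable real function on a probability space is integrable. [folklore] -/
theorem integrable_of_bdd {f : Ω → ℝ} (hf : Measurable f) {M : ℝ} (hM : ∀ ω, |f ω| ≤ M) : Integrable f μ :=
  Integrable.of_bound hf.aestronglyMeasurable M (ae_of_all _ fun ω => by rw [Real.norm_eq_abs]; exact hM ω)

omit [IsProbabilityMeasure μ] in
/-- The product of an a.e. bounded a.e. strongly measurable function with an integrable one is integrable.
[folklore] -/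
theorem integrable_bdd_mul {f g : Ω → ℝ} (hf : AEStronglyMeasurable f μ) {M : ℝ} (hM : ∀ᵐ ω ∂μ, |f ω| ≤ M)
    (hg : Integrable g μ) : Integrable (fun ω => f ω * g ω) μ :=
  hg.bdd_mul hf (hM.mono fun ω hω => by rw [Real.norm_eq_abs]; exact hω)

/-- `∫ (u + v)² = ∫ u² + ∫ v² + 2 ∫ u v` for a.e. bounded functions. [folklore] -/
theorem integral_add_sq {u v : Ω → ℝ} (hu : AEStronglyMeasurable u μ) (hv : AEStronglyMeasurable v μ) {M M' : ℝ}
    (hbu : ∀ᵐ ω ∂μ, |u ω| ≤ M) (hbv : ∀ᵐ ω ∂μ, |v ω| ≤ M') :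
    ∫ ω, (u ω + v ω) ^ 2 ∂μ = ∫ ω, u ω ^ 2 ∂μ + ∫ ω, v ω ^ 2 ∂μ + 2 * ∫ ω, u ω * v ω ∂μ := by
  have hu2 : Integrable (fun ω => u ω ^ 2) μ := integrable_sq_of_ae_bdd_abs hu hbu
  have hv2 : Integrable (fun ω => v ω ^ 2) μ := integrable_sq_of_ae_bdd_abs hv hbv
  have huv : Integrable (fun ω => u ω * v ω) μ := integrable_bdd_mul hu hbu (integrable_of_ae_bdd_abs hv hbv)
  have h12 : Integrable (fun ω => u ω ^ 2 + v ω ^ 2) μ := hu2.add hv2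
  have h3 : Integrable (fun ω => 2 * (u ω * v ω)) μ := huv.const_mul 2
  have e : ∀ ω, (u ω + v ω) ^ 2 = (u ω ^ 2 + v ω ^ 2) + 2 * (u ω * v ω) := fun ω => by ring
  simp_rw [e]
  rw [integral_add h12 h3, integral_add hu2 hv2, integral_const_mul]

/-- **Pull-out against a conditional expectation**: `∫ μ[f|m] · g = ∫ f · g` for a bounded `m`-measurable `g` and an
integrable `f` (`∫ f g = ∫ μ[f g | m] = ∫ g μ[f|m]`). [folklore] -/
theorem integral_condExp_mul_eq (hm : m ≤ m0) {f g : Ω → ℝ} (hf : Integrable f μ)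
    (hg : StronglyMeasurable[m] g) {M : ℝ} (hM : ∀ ω, |g ω| ≤ M) :
    ∫ ω, (μ[f|m]) ω * g ω ∂μ = ∫ ω, f ω * g ω ∂μ := by
  have hgm : AEStronglyMeasurable g μ := (hg.mono hm).aestronglyMeasurable
  have hfg : Integrable (f * g) μ := by
    have h := integrable_bdd_mul hgm (ae_of_all _ hM) hf
    have e : (f * g) = fun ω => g ω * f ω := funext fun ω => mul_comm _ _
    rw [e]; exact h
  have hpull : μ[f * g|m] =ᵐ[μ] μ[f|m] * g := condExp_mul_of_stronglyMeasurable_right hg hfg hf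
  calc ∫ ω, (μ[f|m]) ω * g ω ∂μ = ∫ ω, (μ[f|m] * g) ω ∂μ := rfl
    _ = ∫ ω, (μ[f * g|m]) ω ∂μ := (integral_congr_ae hpull).symm
    _ = ∫ ω, (f * g) ω ∂μ := integral_condExp hm
    _ = ∫ ω, f ω * g ω ∂μ := rfl

/-- **The variance reduction behind Elitzur's mechanism** (abstract form). On a probability space with a
sub-σ-algebra `m`, let `F, F̄` be bounded measurable with `∫ F̄ = ∫ F`, `∫ F̄ F = ∫ F̄²` and `μ[F|m] = μ[F̄|m]` a.e.
If `∫ (F̄ − ∫F̄)² ≤ K ∫ (F̄ − μ[F̄|m])²` with `K ≥ 1`, then `∫ (F − ∫F)² ≤ K ∫ (F − μ[F|m])²`: with `D := F − F̄` one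
has `Var F = Var F̄ + ∫ D²` and `∫ (F − μ[F|m])² = ∫ (F̄ − μ[F̄|m])² + ∫ D²` (all cross terms vanish). [folklore] -/
theorem var_le_of_orbit (hm : m ≤ m0) {F Fb : Ω → ℝ} (hF : Measurable F) (hFb : Measurable Fb) {M : ℝ}
    (hbF : ∀ ω, |F ω| ≤ M) (hbFb : ∀ ω, |Fb ω| ≤ M) (h1 : ∫ ω, Fb ω ∂μ = ∫ ω, F ω ∂μ)
    (h2 : ∫ ω, Fb ω * F ω ∂μ = ∫ ω, Fb ω ^ 2 ∂μ) (h3 : μ[F|m] =ᵐ[μ] μ[Fb|m]) {K : ℝ} (hK : 1 ≤ K)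
    (hGI : ∫ ω, (Fb ω - ∫ ω', Fb ω' ∂μ) ^ 2 ∂μ ≤ K * ∫ ω, (Fb ω - (μ[Fb|m]) ω) ^ 2 ∂μ) :
    ∫ ω, (F ω - ∫ ω', F ω' ∂μ) ^ 2 ∂μ ≤ K * ∫ ω, (F ω - (μ[F|m]) ω) ^ 2 ∂μ := by
  set c : ℝ := ∫ ω, F ω ∂μ with hc
  have hFi : Integrable F μ := integrable_of_bdd hF hbF
  have hFbi : Integrable Fb μ := integrable_of_bdd hFb hbFb
  have hFm := hF.aestronglyMeasurable (μ := μ)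
  have hFbm := hFb.aestronglyMeasurable (μ := μ)
  have hDm : AEStronglyMeasurable (fun ω => F ω - Fb ω) μ := hFm.sub hFbm
  have hDb : ∀ᵐ ω ∂μ, |F ω - Fb ω| ≤ M + M := ae_of_all _ fun ω => (abs_sub _ _).trans (add_le_add (hbF ω) (hbFb ω))
  have hX1 : ∫ ω, (Fb ω - c) * (F ω - Fb ω) ∂μ = 0 := by
    have e : ∀ ω, (Fb ω - c) * (F ω - Fb ω) = (Fb ω * F ω - Fb ω ^ 2) - c * (F ω - Fb ω) := fun ω => by ring
    simp_rw [e]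
    have i1 : Integrable (fun ω => Fb ω * F ω) μ := integrable_bdd_mul hFbm (ae_of_all _ hbFb) hFi
    have i2 : Integrable (fun ω => Fb ω ^ 2) μ := integrable_sq_of_ae_bdd_abs hFbm (ae_of_all _ hbFb)
    have i12 : Integrable (fun ω => Fb ω * F ω - Fb ω ^ 2) μ := i1.sub i2
    have iD : Integrable (fun ω => F ω - Fb ω) μ := hFi.sub hFbi
    have i3 : Integrable (fun ω => c * (F ω - Fb ω)) μ := iD.const_mul c
    rw [integral_sub i12 i3, integral_sub i1 i2, integral_const_mul, integral_sub hFi hFbi, h2, h1]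
    ring
  have hPb : ∀ᵐ ω ∂μ, |(μ[Fb|m]) ω| ≤ M := ae_bdd_abs_condExp_of_ae_bdd_abs (ae_of_all _ hbFb)
  have hPm : AEStronglyMeasurable (μ[Fb|m]) μ := integrable_condExp.aestronglyMeasurable
  have hX2 : ∫ ω, (Fb ω - (μ[Fb|m]) ω) * (F ω - Fb ω) ∂μ = 0 := by
    obtain ⟨g, hgm, hgb, hg⟩ := exists_stronglyMeasurable_truncation
      (stronglyMeasurable_condExp (m := m) (μ := μ) (f := Fb)) M
    have hgae : g =ᵐ[μ] μ[Fb|m] := hPb.mono fun ω hω => hg ω hω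
    have hgF : ∫ ω, g ω * F ω ∂μ = ∫ ω, g ω * Fb ω ∂μ := by
      have a1 : ∫ ω, (μ[F|m]) ω * g ω ∂μ = ∫ ω, F ω * g ω ∂μ := integral_condExp_mul_eq hm hFi hgm hgb
      have a2 : ∫ ω, (μ[Fb|m]) ω * g ω ∂μ = ∫ ω, Fb ω * g ω ∂μ := integral_condExp_mul_eq hm hFbi hgm hgb
      have a3 : ∫ ω, (μ[F|m]) ω * g ω ∂μ = ∫ ω, (μ[Fb|m]) ω * g ω ∂μ :=
        integral_congr_ae (h3.mono fun ω hω => by simp only [hω])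
      have e1 : ∫ ω, g ω * F ω ∂μ = ∫ ω, F ω * g ω ∂μ := integral_congr_ae (ae_of_all _ fun ω => mul_comm _ _)
      have e2 : ∫ ω, g ω * Fb ω ∂μ = ∫ ω, Fb ω * g ω ∂μ := integral_congr_ae (ae_of_all _ fun ω => mul_comm _ _)
      rw [e1, e2, ← a1, ← a2, a3]
    have hrepl : ∫ ω, (Fb ω - (μ[Fb|m]) ω) * (F ω - Fb ω) ∂μ = ∫ ω, (Fb ω - g ω) * (F ω - Fb ω) ∂μ :=
      integral_congr_ae (hgae.mono fun ω hω => by simp only [hω])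
    rw [hrepl]
    have e : ∀ ω, (Fb ω - g ω) * (F ω - Fb ω) = (Fb ω * F ω - Fb ω ^ 2) - (g ω * F ω - g ω * Fb ω) := fun ω => by
      ring
    simp_rw [e]
    have hgm0 : AEStronglyMeasurable g μ := (hgm.mono hm).aestronglyMeasurable
    have i1 : Integrable (fun ω => Fb ω * F ω) μ := integrable_bdd_mul hFbm (ae_of_all _ hbFb) hFi
    have i2 : Integrable (fun ω => Fb ω ^ 2) μ := integrable_sq_of_ae_bdd_abs hFbm (ae_of_all _ hbFb)
    have i3 : Integrable (fun ω => g ω * F ω) μ := integrable_bdd_mul hgm0 (ae_of_all _ hgb) hFi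
    have i4 : Integrable (fun ω => g ω * Fb ω) μ := integrable_bdd_mul hgm0 (ae_of_all _ hgb) hFbi
    have i12 : Integrable (fun ω => Fb ω * F ω - Fb ω ^ 2) μ := i1.sub i2
    have i34 : Integrable (fun ω => g ω * F ω - g ω * Fb ω) μ := i3.sub i4
    rw [integral_sub i12 i34, integral_sub i1 i2, integral_sub i3 i4, h2, hgF]
    ring
  have hcb : |c| ≤ M := by
    have := norm_integral_le_of_norm_le_const (μ := μ) (f := F) (C := M)
      (ae_of_all _ fun ω => by rw [Real.norm_eq_abs]; exact hbF ω)
    simpa only [Real.norm_eq_abs, probReal_univ, mul_one] using this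
  have hV : ∫ ω, (F ω - c) ^ 2 ∂μ = ∫ ω, (Fb ω - c) ^ 2 ∂μ + ∫ ω, (F ω - Fb ω) ^ 2 ∂μ := by
    have e : ∀ ω, F ω - c = (Fb ω - c) + (F ω - Fb ω) := fun ω => by ring
    simp_rw [e]
    have hum : AEStronglyMeasurable (fun ω => Fb ω - c) μ := hFbm.sub aestronglyMeasurable_const
    rw [integral_add_sq (u := fun ω => Fb ω - c) (v := fun ω => F ω - Fb ω) hum hDm (M := M + M) (M' := M + M)
      (ae_of_all _ fun ω => (abs_sub _ _).trans (add_le_add (hbFb ω) hcb)) hDb, hX1]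
    ring
  have hW : ∫ ω, (F ω - (μ[F|m]) ω) ^ 2 ∂μ =
      ∫ ω, (Fb ω - (μ[Fb|m]) ω) ^ 2 ∂μ + ∫ ω, (F ω - Fb ω) ^ 2 ∂μ := by
    have e : (fun ω => (F ω - (μ[F|m]) ω) ^ 2) =ᵐ[μ] fun ω => ((Fb ω - (μ[Fb|m]) ω) + (F ω - Fb ω)) ^ 2 :=
      h3.mono fun ω hω => by simp only [hω]; ring
    have hum : AEStronglyMeasurable (fun ω => Fb ω - (μ[Fb|m]) ω) μ := hFbm.sub hPm
    rw [integral_congr_ae e, integral_add_sq (u := fun ω => Fb ω - (μ[Fb|m]) ω) (v := fun ω => F ω - Fb ω) hum hDm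
      (M := M + M) (M' := M + M) (ae_abs_sub_le_add (ae_of_all _ hbFb) hPb) hDb, hX2]
    ring
  have hD0 : 0 ≤ ∫ ω, (F ω - Fb ω) ^ 2 ∂μ := integral_nonneg fun ω => sq_nonneg _
  have hcFb : ∫ ω', Fb ω' ∂μ = c := h1
  rw [hcFb] at hGI
  rw [hV, hW, mul_add]
  nlinarith [hGI, hD0, hK]

end Abstract

section Geometry

variable {G : Type} [Group G] {S : ℕ}

/-- Unfolding of a gauge transformation on one link. [folklore] -/
theorem gaugeTransform_apply (g : Site 4 (2 * S + 1) → G) (U : GaugeConfig 4 (2 * S + 1) G)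
    (e : Edge 4 (2 * S + 1)) : gaugeTransform g U e = g e.1 * U e * (g (e.1.shift e.2))⁻¹ := rfl

/-- The trivial gauge transformation acts trivially. [folklore] -/
theorem gaugeTransform_one (U : GaugeConfig 4 (2 * S + 1) G) : gaugeTransform (1 : Site 4 (2 * S + 1) → G) U = U := by
  funext e; simp [gaugeTransform]

/-- **Both endpoints of a slab link touch the slab**: their time-offsets from `t₀` are `≤ w`. [folklore] -/
theorem endpoints_of_slab {t₀ : ZMod (2 * S + 1)} {w : ℕ} {e : Edge 4 (2 * S + 1)} (he : (e.1 0 - t₀).val < w) :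
    (e.1 0 - t₀).val < w + 1 ∧ ((e.1.shift e.2) 0 - t₀).val < w + 1 := by
  refine ⟨Nat.lt_succ_of_lt he, ?_⟩
  rcases val_shift_apply_sub_eq_or e.1 e.2 0 t₀ with h | h
  · rw [h]; exact Nat.lt_succ_of_lt he
  · rw [h]
    rcases Nat.lt_or_ge ((e.1 0 - t₀).val + 1) (2 * S + 1) with h1 | h1
    · rw [Nat.mod_eq_of_lt h1]; omega
    · have h2 : (e.1 0 - t₀).val + 1 = 2 * S + 1 := le_antisymm (ZMod.val_lt _) h1
      rw [h2, Nat.mod_self]; omega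

/-- **No endpoint of an exterior link touches the slab** (`D ≥ 2`): a link off the `(D−1)`-enlarged slab has both
endpoints at time-offset `> w` from `t₀`. [folklore] -/
theorem endpoints_of_exterior {t₀ : ZMod (2 * S + 1)} {w D : ℕ} (hD : 2 ≤ D) {e : Edge 4 (2 * S + 1)}
    (he : ¬ (e.1 0 - (t₀ - ((D - 1 : ℕ) : ZMod (2 * S + 1)))).val < w + 2 * (D - 1)) :
    ¬ (e.1 0 - t₀).val < w + 1 ∧ ¬ ((e.1.shift e.2) 0 - t₀).val < w + 1 := by
  set u := (e.1 0 - (t₀ - ((D - 1 : ℕ) : ZMod (2 * S + 1)))).val with hu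
  have hule : w + 2 * (D - 1) ≤ u := Nat.le_of_not_lt he
  have hult : u < 2 * S + 1 := ZMod.val_lt _
  have hkey : e.1 0 - t₀ = ((u - (D - 1) : ℕ) : ZMod (2 * S + 1)) := by
    have h1 : e.1 0 - t₀ = (e.1 0 - (t₀ - ((D - 1 : ℕ) : ZMod (2 * S + 1)))) - ((D - 1 : ℕ) : ZMod (2 * S + 1)) := by
      ring
    rw [h1, ← ZMod.natCast_zmod_val (e.1 0 - (t₀ - ((D - 1 : ℕ) : ZMod (2 * S + 1)))), ← hu,
      Nat.cast_sub (by omega : D - 1 ≤ u)]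
  have hval : (e.1 0 - t₀).val = u - (D - 1) := by
    rw [hkey, ZMod.val_cast_of_lt (by omega : u - (D - 1) < 2 * S + 1)]
  refine ⟨by rw [hval]; omega, ?_⟩
  rcases val_shift_apply_sub_eq_or e.1 e.2 0 t₀ with h | h
  · rw [h, hval]; omega
  · rw [h, hval]
    have : u - (D - 1) + 1 < 2 * S + 1 := by omega
    rw [Nat.mod_eq_of_lt this]; omega

variable (t₀ : ZMod (2 * S + 1)) (w : ℕ)

/-- **On slab observables a gauge transformation acts only through its values at the sites touching the slab**
(time-offsets `0, …, w` from `t₀`). [folklore] -/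
theorem apply_gaugeTransform_eq_of_agree {F : GaugeConfig 4 (2 * S + 1) G → ℝ}
    (hF : DependsOn F {ℓ : Edge 4 (2 * S + 1) | (ℓ.1 0 - t₀).val < w}) {g γ : Site 4 (2 * S + 1) → G}
    (hγ : ∀ x, (x 0 - t₀).val < w + 1 → γ x = g x) (U : GaugeConfig 4 (2 * S + 1) G) :
    F (gaugeTransform g U) = F (gaugeTransform γ U) := by
  refine hF fun e he => ?_
  obtain ⟨h1, h2⟩ := endpoints_of_slab (S := S) he
  simp only [gaugeTransform_apply, hγ _ h1, hγ _ h2]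

/-- **A gauge transformation supported on the sites touching the slab fixes every exterior link** (`D ≥ 2`), hence
every exterior observable. [folklore] -/
theorem apply_gaugeTransform_eq_of_exterior {D : ℕ} (hD : 2 ≤ D) {H : GaugeConfig 4 (2 * S + 1) G → ℝ}
    (hH : DependsOn H {ℓ : Edge 4 (2 * S + 1) | (ℓ.1 0 - (t₀ - ((D - 1 : ℕ) : ZMod (2 * S + 1)))).val < w + 2 * (D - 1)}ᶜ)
    {γ : Site 4 (2 * S + 1) → G} (hγ : ∀ x, ¬ (x 0 - t₀).val < w + 1 → γ x = 1) (U : GaugeConfig 4 (2 * S + 1) G) :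
    H (gaugeTransform γ U) = H U := by
  refine hH fun e he => ?_
  obtain ⟨h1, h2⟩ := endpoints_of_exterior (S := S) (t₀ := t₀) hD (e := e) he
  simp only [gaugeTransform_apply, hγ _ h1, hγ _ h2, one_mul, inv_one, mul_one]

/-- The orbit integrand of a slab observable is again a slab observable, for every `g`. [folklore] -/
theorem dependsOn_comp_gaugeTransform {F : GaugeConfig 4 (2 * S + 1) G → ℝ}
    (hF : DependsOn F {ℓ : Edge 4 (2 * S + 1) | (ℓ.1 0 - t₀).val < w}) (g : Site 4 (2 * S + 1) → G) :
    DependsOn (fun U => F (gaugeTransform g U)) {ℓ : Edge 4 (2 * S + 1) | (ℓ.1 0 - t₀).val < w} :=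
  fun _ _ hUV => hF fun e he => by simp only [gaugeTransform_apply, hUV e he]

end Geometry

section Wilson

variable {G : Type} [Group G] [TopologicalSpace G] [IsTopologicalGroup G] [CompactSpace G]
  [MeasurableSpace G] [BorelSpace G]

/-- **KEY IDENTITY (Elitzur's mechanism).** For `μ = wilsonMeasure r.ρ β` on the torus of side `2S+1`, the orbit
average `F̄ U = ∫ F(U^g) dπ(g)` (`π` the product Haar probability measure of the gauge group) of a bounded measurable
observable `F` of the slab `(t₀, w)`, and every bounded measurable `H` invariant under the gauge transformations
supported on the sites touching the slab: `∫ F̄ H dμ = ∫ F H dμ`. [folklore] -/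
theorem integral_orbitAverage_mul (r : LatticeRep G) (β : ℝ) (S : ℕ) (t₀ : ZMod (2 * S + 1)) (w : ℕ)
    {F : GaugeConfig 4 (2 * S + 1) G → ℝ} (hFm : Measurable F) {M : ℝ} (hbF : ∀ U, |F U| ≤ M)
    (hFd : DependsOn F {ℓ : Edge 4 (2 * S + 1) | (ℓ.1 0 - t₀).val < w})
    {H : GaugeConfig 4 (2 * S + 1) G → ℝ} (hHm : Measurable H) {M' : ℝ} (hbH : ∀ U, |H U| ≤ M')
    (hH : ∀ γ : Site 4 (2 * S + 1) → G, (∀ x, ¬ (x 0 - t₀).val < w + 1 → γ x = 1) →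
      ∀ U, H (gaugeTransform γ U) = H U) :
    ∫ U, (∫ g, F (gaugeTransform g U) ∂(Measure.pi fun _ : Site 4 (2 * S + 1) => haarProbability G)) * H U
        ∂(wilsonMeasure (d := 4) (L := 2 * S + 1) r.ρ β) =
      ∫ U, F U * H U ∂(wilsonMeasure (d := 4) (L := 2 * S + 1) r.ρ β) := by
  haveI : SecondCountableTopology G :=
    (r.continuous.isClosedEmbedding r.injective).isEmbedding.secondCountableTopology
  set μ : Measure (GaugeConfig 4 (2 * S + 1) G) := wilsonMeasure (d := 4) (L := 2 * S + 1) r.ρ β with hμ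
  set π : Measure (Site 4 (2 * S + 1) → G) := Measure.pi fun _ : Site 4 (2 * S + 1) => haarProbability G with hπ
  haveI : IsProbabilityMeasure μ := isProbabilityMeasure_wilsonMeasure (d := 4) (L := 2 * S + 1) r.ρ r.continuous β
  have hact : Measurable fun p : (Site 4 (2 * S + 1) → G) × GaugeConfig 4 (2 * S + 1) G =>
      gaugeTransform p.1 p.2 :=
    (continuous_gaugeAction_univ (d := 4) (L := 2 * S + 1) (G := G)).measurable
  have hjm : Measurable fun p : GaugeConfig 4 (2 * S + 1) G × (Site 4 (2 * S + 1) → G) =>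
      F (gaugeTransform p.2 p.1) * H p.1 :=
    (hFm.comp (hact.comp measurable_swap)).mul (hHm.comp measurable_fst)
  have hM0 : 0 ≤ M := (abs_nonneg _).trans (hbF 1)
  have hbd : ∀ p : GaugeConfig 4 (2 * S + 1) G × (Site 4 (2 * S + 1) → G),
      ‖F (gaugeTransform p.2 p.1) * H p.1‖ ≤ M * M' := fun p => by
    rw [norm_mul, Real.norm_eq_abs, Real.norm_eq_abs]
    exact mul_le_mul (hbF _) (hbH _) (abs_nonneg _) hM0
  have hint : Integrable (Function.uncurry fun U g => F (gaugeTransform g U) * H U) (μ.prod π) :=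
    Integrable.of_bound hjm.aestronglyMeasurable (M * M') (ae_of_all _ fun p => hbd p)
  have hinner : ∀ g : Site 4 (2 * S + 1) → G, ∫ U, F (gaugeTransform g U) * H U ∂μ = ∫ U, F U * H U ∂μ := by
    intro g
    -- truncate `g` to the sites touching the slab
    obtain ⟨γ, hγA, hγ1⟩ : ∃ γ : Site 4 (2 * S + 1) → G,
        (∀ x, (x 0 - t₀).val < w + 1 → γ x = g x) ∧ (∀ x, ¬ (x 0 - t₀).val < w + 1 → γ x = 1) :=
      ⟨fun x => if (x 0 - t₀).val < w + 1 then g x else 1, fun x hx => if_pos hx, fun x hx => if_neg hx⟩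
    have hγ : ∀ x, ¬ (x 0 - t₀).val < w + 1 → γ⁻¹ x = 1 := fun x hx => by
      rw [Pi.inv_apply, hγ1 x hx, inv_one]
    calc ∫ U, F (gaugeTransform g U) * H U ∂μ
        = ∫ U, F (gaugeTransform γ U) * H U ∂μ := by
          refine integral_congr_ae (ae_of_all _ fun U => ?_)
          simp only [apply_gaugeTransform_eq_of_agree t₀ w hFd hγA U]
      _ = ∫ U, F (gaugeTransform γ (gaugeTransform γ⁻¹ U)) * H (gaugeTransform γ⁻¹ U) ∂μ :=
          (integral_comp_gaugeTransform_wilsonMeasure r.ρ β γ⁻¹ (fun U => F (gaugeTransform γ U) * H U)).symm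
      _ = ∫ U, F U * H U ∂μ := by
          refine integral_congr_ae (ae_of_all _ fun U => ?_)
          simp only [← gaugeTransform_mul, mul_inv_cancel, gaugeTransform_one, hH _ hγ U]
  calc ∫ U, (∫ g, F (gaugeTransform g U) ∂π) * H U ∂μ
      = ∫ U, (∫ g, F (gaugeTransform g U) * H U ∂π) ∂μ := by
        refine integral_congr_ae (ae_of_all _ fun U => ?_)
        simp only [integral_mul_const]
    _ = ∫ g, (∫ U, F (gaugeTransform g U) * H U ∂μ) ∂π := integral_integral_swap hint
    _ = ∫ U, F U * H U ∂μ := by simp only [hinner, integral_const, probReal_univ, one_smul]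

end Wilson

end GaugeReduction

open GaugeReduction in
/-- **Stub S1r of line `femto-slab-nondegeneracy`** (gauge reduction of the slab inequality, Elitzur): for every
compact `G`, unitary `r`, coupling `β`, torus `S`, margin `D ≥ 2` and `K ≥ 1`, the slab inequality for gauge-invariant
closed-slab observables implies the slab inequality for all bounded measurable closed-slab observables (slab by slab:
orbit-average `F`, the three orthogonality facts from `integral_orbitAverage_mul`, then `var_le_of_orbit`). -/
theorem stub_gaugeReduction : ∀ (G : Type) [Group G] [TopologicalSpace G] [IsTopologicalGroup G] [CompactSpace G] [MeasurableSpace G] [BorelSpace G] (r : LatticeRep G) (β : ℝ) (S D : ℕ) (K : ℝ) (μ : Measure (GaugeConfig 4 (2 * S + 1) G)), μ = (wilsonMeasure r.ρ β : Measure (GaugeConfig 4 (2 * S + 1) G)) → 2 ≤ D → 1 ≤ K → (∀ (t₀ : ZMod (2 * S + 1)) (w : ℕ), w + 2 * D ≤ 2 * S → ∀ F : GaugeConfig 4 (2 * S + 1) G → ℝ, Measurable F → (∃ M : ℝ, ∀ U, |F U| ≤ M) → IsGaugeInvariant F → DependsOn F {ℓ : Edge 4 (2 * S + 1) | (ℓ.1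 0 - t₀).val < w} → ∫ U, (F U - ∫ V, F V ∂μ) ^ 2 ∂μ ≤ K * ∫ U, (F U - (μ[F|cylinderEvents {ℓ : Edge 4 (2 * S + 1) | (ℓ.1 0 - (t₀ - ((D - 1 : ℕ) : ZMod (2 * S + 1)))).val < w + 2 * (D - 1)}ᶜ]) U) ^ 2 ∂μ) → ∀ (t₀ : ZMod (2 * S + 1)) (w : ℕ), w + 2 * D ≤ 2 * S → ∀ F : GaugeConfig 4 (2 * S + 1) G → ℝ, Measurable F → (∃ M : ℝ, ∀ U, |F U| ≤ M) → DependsOn F {ℓ : Edge 4 (2 * S + 1) | (ℓ.1 0 - t₀).val < w} → ∫ U, (F U - ∫ V, F V ∂μ) ^ 2 ∂μ ≤ K * ∫ U, (F U - (μ[F|cylinderEvents {ℓ : Edge 4 (2 * S + 1) | (ℓ.1 0 - (t₀ - ((D - 1 : ℕ) : ZMod (2 * S + 1)))).val < w + 2 * (D - 1)}ᶜ]) U) ^ 2 ∂μ := by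
  intro G _ _ _ _ _ _ r β S D K μ hμ0 hD hK hGI t₀ w hw F hFm hFb hFd
  subst hμ0
  haveI : SecondCountableTopology G :=
    (r.continuous.isClosedEmbedding r.injective).isEmbedding.secondCountableTopology
  set μ : Measure (GaugeConfig 4 (2 * S + 1) G) := wilsonMeasure (d := 4) (L := 2 * S + 1) r.ρ β with hμ
  set π : Measure (Site 4 (2 * S + 1) → G) := Measure.pi fun _ : Site 4 (2 * S + 1) => haarProbability G with hπ
  set ext : Set (Edge 4 (2 * S + 1)) :=
    {ℓ : Edge 4 (2 * S + 1) | (ℓ.1 0 - (t₀ - ((D - 1 : ℕ) : ZMod (2 * S + 1)))).val < w + 2 * (D - 1)}ᶜ with hext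
  haveI : IsProbabilityMeasure μ := isProbabilityMeasure_wilsonMeasure (d := 4) (L := 2 * S + 1) r.ρ r.continuous β
  have hm : cylinderEvents (X := fun _ : Edge 4 (2 * S + 1) => G) ext ≤
      (MeasurableSpace.pi : MeasurableSpace (GaugeConfig 4 (2 * S + 1) G)) := cylinderEvents_le_pi
  obtain ⟨M, hbF⟩ := hFb
  have hact : Measurable fun p : (Site 4 (2 * S + 1) → G) × GaugeConfig 4 (2 * S + 1) G =>
      gaugeTransform p.1 p.2 :=
    (continuous_gaugeAction_univ (d := 4) (L := 2 * S + 1) (G := G)).measurable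
  set Fb : GaugeConfig 4 (2 * S + 1) G → ℝ := fun U => ∫ g, F (gaugeTransform g U) ∂π with hFbdef
  have hFbm : Measurable Fb := measurable_orbitAverage hact hFm
  have hbFb : ∀ U, |Fb U| ≤ M := abs_orbitAverage_le _ hbF
  have hFbi : IsGaugeInvariant Fb := isGaugeInvariant_orbitAverage F
  have hFbd : DependsOn Fb {ℓ : Edge 4 (2 * S + 1) | (ℓ.1 0 - t₀).val < w} := by
    intro U V hUV
    simp only [hFbdef]
    exact integral_congr_ae (ae_of_all _ fun g => dependsOn_comp_gaugeTransform t₀ w hFd g hUV)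
  have hFi : Integrable F μ := integrable_of_bdd hFm hbF
  have hFbI : Integrable Fb μ := integrable_of_bdd hFbm hbFb
  have h1 : ∫ U, Fb U ∂μ = ∫ U, F U ∂μ := by
    have := integral_orbitAverage_mul r β S t₀ w hFm hbF hFd (H := fun _ => (1 : ℝ)) measurable_const
      (M' := 1) (fun _ => by simp) (fun _ _ _ => rfl)
    simpa only [mul_one] using this
  have h2 : ∫ U, Fb U * F U ∂μ = ∫ U, Fb U ^ 2 ∂μ := by
    have := integral_orbitAverage_mul r β S t₀ w hFm hbF hFd (H := Fb) hFbm hbFb (fun γ _ U => hFbi γ U)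
    calc ∫ U, Fb U * F U ∂μ = ∫ U, F U * Fb U ∂μ := integral_congr_ae (ae_of_all _ fun U => mul_comm _ _)
      _ = ∫ U, Fb U * Fb U ∂μ := this.symm
      _ = ∫ U, Fb U ^ 2 ∂μ := integral_congr_ae (ae_of_all _ fun U => (sq (Fb U)).symm)
  have h3 : μ[F|cylinderEvents (X := fun _ : Edge 4 (2 * S + 1) => G) ext] =ᵐ[μ]
      μ[Fb|cylinderEvents (X := fun _ : Edge 4 (2 * S + 1) => G) ext] := by
    have hQ : StronglyMeasurable[cylinderEvents (X := fun _ : Edge 4 (2 * S + 1) => G) ext]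
        (μ[(fun U => F U - Fb U)|cylinderEvents (X := fun _ : Edge 4 (2 * S + 1) => G) ext]) :=
      stronglyMeasurable_condExp
    have hQb : ∀ᵐ U ∂μ, |(μ[(fun U => F U - Fb U)|cylinderEvents (X := fun _ : Edge 4 (2 * S + 1) => G) ext]) U| ≤
        M + M :=
      ae_bdd_abs_condExp_of_ae_bdd_abs (ae_of_all _ fun U => (abs_sub _ _).trans (add_le_add (hbF U) (hbFb U)))
    obtain ⟨g₀, hg₀m, hg₀b, hg₀⟩ := exists_stronglyMeasurable_truncation hQ (M + M)
    have hg₀ae : g₀ =ᵐ[μ] μ[(fun U => F U - Fb U)|cylinderEvents (X := fun _ : Edge 4 (2 * S + 1) => G) ext] :=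
      hQb.mono fun U hU => hg₀ U hU
    have hg₀meas : Measurable g₀ := (hg₀m.mono hm).measurable
    have hg₀dep : DependsOn g₀ ext := dependsOn_of_measurable_cylinderEvents_real hg₀m.measurable
    have hg₀inv : ∀ γ : Site 4 (2 * S + 1) → G, (∀ x, ¬ (x 0 - t₀).val < w + 1 → γ x = 1) →
        ∀ U, g₀ (gaugeTransform γ U) = g₀ U := fun γ hγ U =>
      apply_gaugeTransform_eq_of_exterior t₀ w hD hg₀dep hγ U
    have hkey : ∫ U, (F U - Fb U) * g₀ U ∂μ = 0 := by
      have e := integral_orbitAverage_mul r β S t₀ w hFm hbF hFd hg₀meas hg₀b hg₀inv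
      have i1 : Integrable (fun U => F U * g₀ U) μ := by
        simpa only [mul_comm] using integrable_bdd_mul (hg₀meas.aestronglyMeasurable) (ae_of_all _ hg₀b) hFi
      have i2 : Integrable (fun U => Fb U * g₀ U) μ := by
        simpa only [mul_comm] using integrable_bdd_mul (hg₀meas.aestronglyMeasurable) (ae_of_all _ hg₀b) hFbI
      have esub : ∀ U, (F U - Fb U) * g₀ U = F U * g₀ U - Fb U * g₀ U := fun U => by ring
      simp_rw [esub]
      rw [integral_sub i1 i2, e, sub_self]
    have hsq : ∫ U, g₀ U ^ 2 ∂μ = 0 := by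
      have a1 : ∫ U, (μ[(fun U => F U - Fb U)|cylinderEvents (X := fun _ : Edge 4 (2 * S + 1) => G) ext]) U * g₀ U ∂μ =
          ∫ U, (F U - Fb U) * g₀ U ∂μ :=
        integral_condExp_mul_eq hm (f := fun U => F U - Fb U) (hFi.sub hFbI) hg₀m hg₀b
      rw [hkey] at a1
      rw [← a1]
      refine integral_congr_ae (hg₀ae.mono fun U hU => ?_)
      simp only [← hU, sq]
    have hg₀zero : g₀ =ᵐ[μ] 0 := by
      have hi : Integrable (fun U => g₀ U ^ 2) μ :=
        integrable_sq_of_ae_bdd_abs hg₀meas.aestronglyMeasurable (ae_of_all _ hg₀b)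
      have := (integral_eq_zero_iff_of_nonneg (fun U => sq_nonneg (g₀ U)) hi).1 hsq
      filter_upwards [this] with U hU
      simpa using hU
    have hsubae : μ[(fun U => F U - Fb U)|cylinderEvents (X := fun _ : Edge 4 (2 * S + 1) => G) ext] =ᵐ[μ] 0 :=
      hg₀ae.symm.trans hg₀zero
    have hlin : μ[(fun U => F U - Fb U)|cylinderEvents (X := fun _ : Edge 4 (2 * S + 1) => G) ext] =ᵐ[μ]
        μ[F|cylinderEvents (X := fun _ : Edge 4 (2 * S + 1) => G) ext] -
          μ[Fb|cylinderEvents (X := fun _ : Edge 4 (2 * S + 1) => G) ext] :=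
      condExp_sub hFi hFbI _
    filter_upwards [hsubae, hlin] with U h0 hl
    have h' : (μ[F|cylinderEvents (X := fun _ : Edge 4 (2 * S + 1) => G) ext] -
        μ[Fb|cylinderEvents (X := fun _ : Edge 4 (2 * S + 1) => G) ext]) U = 0 := by
      rw [← hl, h0]; rfl
    rw [Pi.sub_apply] at h'
    linarith
  exact var_le_of_orbit hm hFm hFbm hbF hbFb h1 h2 h3 hK (hGI t₀ w hw Fb hFbm ⟨M, hbFb⟩ hFbi hFbd)

end Summit.QuantumFields.YangMills.Theorems.LatticeGapInUVUnits.FemtoSlabNondegeneracy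

end
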